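import Summits.BirchSwinnertonDyer.BirchSwinnertonDyer.Theses.VerticalContact
import Summits.BirchSwinnertonDyer.BirchSwinnertonDyer.Theorems.VerticalContactVerticalSelmerBoundStubSelmerLengthLB

/-!
# Line `toric-control` for crux `VerticalSelmerBound` — rev 4 (item stmt-BirchSwinnertonDyer-18131, route VerticalContact)

Crux-strategist skeleton (planner-cstrat-stmt-BirchSwinnertonDyer-18432-b1-0, 2026-08-17), led by
prover-line-stmt-BirchSwinnertonDyer-18432-0 (cycle 1: three stubs landed) and re-pointed to the rev-4 RESTATE by the
continuation lead prover-line-stmt-BirchSwinnertonDyer-18432-c1-0 (2026-08-17T13:15Z): the route decl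
`Summit.BirchSwinnertonDyer.BirchSwinnertonDyer.Theses.VerticalContact.VerticalSelmerBound` now carries the restated type
(planner rrepair-6946c063, route rev 4: `∃ C'` hoisted above the coefficient data `F, 𝔓, ι, e, e'`; on-branch weight clause
`2(p-1)p^N·h_K ∣ k-2`) — verbatim the type of the former `VerticalSelmerBoundR_of` of this file. Consequently the line is now
ONE open stub:

* `stub_selmerLengthLB` (elementary) — LANDED, p159065
  (`Theorems/VerticalContactVerticalSelmerBoundStubSelmerLengthLB.lean`), discharged by name below:
  `p^(n·(corank Sel_p∞(E/ℚ) + corank Sel_p∞(E^{d_K}/ℚ))) ≤ #Sel^(p^n)(E/K) · p^c`.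
* `stub_uniformToricControl` (deep, the literature leaf in its PRINTED shape, typed F-UNIFORMLY and on the branch; OPEN; the
  continuation lead's PROMOTE dossier `Cruxes/VerticalSelmerBound/PROMOTE-stub_uniformToricControl.md` explains why it is
  crux-sized and gives the layer-2 cut F1 JL / F2 Deligne–Carayol / F3 Selmer comparison / C4 uniform vertical control / G5 glue):
  for every admissible weight-`k` eigenform `Φ` at depth `N`, `#Sel^(p^(N+1))(E/K) ≤ p^(j + C₂)` with
  `val(P)² ≤ val(Φ(I₀)(e₀))²·val(p)^j`.
* The rev-1 artefact stubs are GONE with the restate: `stub_normalisingWitness` (landed p159523) and `stub_offBranchVacuous`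
  (landed p160213) remain in the tree as by-products; `stub_offBranchFiniteNonCoprime` (Hida 2011 artefact; stub-worker verdict
  13:10Z: stub-blocked, no tree objects) is no longer needed by any composition.

`VerticalSelmerBound_of` composes the deep stub with the landed lower bound into the crux BY NAME (ℕ-arithmetic only).
-/

namespace Summit.BirchSwinnertonDyer.BirchSwinnertonDyer.Cruxes.VerticalSelmerBound.ToricControl

open scoped BigOperators Topology Manifold Classical MeasureTheory ProbabilityTheory Matrix InnerProductSpace ComplexConjugate ContinuousMap
open Filter Set Function TopologicalSpace MeasureTheory
open Literature
open Summit.BirchSwinnertonDyer.BirchSwinnertonDyer.Theses.VerticalContact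

set_option linter.dupNamespace false

/-- **Stub 1 (elementary): finite-level Selmer length is bounded below by the coranks.** For `E/ℚ`, a prime `p`
and a quadratic field `K`, `p^(n·(corank Sel_p∞(E/ℚ) + corank Sel_p∞(E^{d_K}/ℚ))) ≤ #Sel^(p^n)(E/K)·p^c` for all `n`.
Divisible part of `Sel_p∞(E/K)`, the surjection `Sel^(p^n)(E/K) ↠ Sel_p∞(E/K)[p^n]`, DD2010 Lem. 4.14. -/
theorem stub_selmerLengthLB :
    ∀ (W : WeierstrassCurve ℚ) [W.IsElliptic] (p : ℕ) [Fact p.Prime] (K : Type) [Field K] [NumberField K], Module.finrank ℚ K = 2 → ∃ c : ℕ, ∀ n : ℕ, p ^ (n * (W.selmerCorank p + (W.quadraticTwist (NumberField.discr K : ℚ)).selmerCorank p)) ≤ Nat.card ↥((W.baseChange K).selmerGroup ((p : ℤ) ^ n)) * p ^ c := by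
  exact Summit.BirchSwinnertonDyer.BirchSwinnertonDyer.Theorems.stub_selmerLengthLB

/-- **Stub 2 (deep, literature leaf in printed shape): uniform toric control of the `p^(N+1)`-Selmer group over `K`.**
F-uniform (`∃ C₂` before the coefficient field) and on the branch `2(p-1)p^N·h_K ∣ k-2`. CKL2017 Cor. 5.4 + control at `χ̂_k` +
Chida–Hsieh/Castella–Longo interpolation + residual Selmer rigidity. -/
theorem stub_uniformToricControl :
    ∀ (W : WeierstrassCurve ℚ) [W.IsElliptic] [W.IsGloballyMinimal] (p : ℕ) [Fact p.Prime] (K : Type) [Field K] [NumberField K] (Nplus Nminus : ℕ) (a b : ℚ), let B := QuaternionAlgebra ℚ a 0 b; let R := NumberField.RingOfIntegers K; ∀ (O : Subring B) (ψ : K →ₐ[ℚ] B) (I₁ : Submodule ℤ B) (a₀ : ClassGroup R → nonZeroDivisors (Ideal R)) (α : ClassGroup R → R), let Λ := Submodule ℤ B; let hK := NumberField.classNumber K; let dK := NumberField.discr K; let spl : ℕ → ℕ := fun q => ((Ideal.span {(q : ℤ)}).primesOver R).ncard; let RI : Set Λ := {J | J.FG ∧ (∀ d : B, ∃ n : ℤ,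 n ≠ 0 ∧ n • d ∈ J) ∧ (∀ x : B, (∀ y ∈ J, y * x ∈ J) ↔ x ∈ O) ∧ ∃ J' : Λ, (∀ x : B, x ∈ J * J' ↔ ∀ y ∈ J, x * y ∈ J) ∧ (∀ x : B, x ∈ J' * J ↔ x ∈ O)}; let PT : Λ → Prop := fun I => ∃ n₀ : ℕ, n₀.Coprime p ∧ (∀ x ∈ O, (n₀ : ℤ) • x ∈ I) ∧ ∀ x ∈ I, (n₀ : ℤ) • x ∈ O; let L : ClassGroup R → Λ := fun c => Submodule.span ℤ ((fun x : R => ψ (x : K)) '' (a₀ c).1) * I₁; let HG : Λ → Prop := fun J => J ∈ RI ∧ (∀ x : R, ∀ y ∈ J, ψ (x : K) * y ∈ J) ∧ ∀ x : K, (∀ y ∈ J, ψ x * y ∈ J) → ∃ z : R, (z : K) = x; ((5 ≤ p ∧ W.HasGoodReductionAtPrime p ∧ ¬ (p : ℤ) ∣ W.frobeniusTrace p ∧ W.HasSurjectiveModNGaloisRep p ∧ ¬ p ∣ 6 * hK ∧ Int.gcd dK (W.conductorNorm ℤ * p) = 1) ∧ (Module.finrank ℚ K = 2 ∧ NumberField.IsTotallyComplex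 K ∧ dK < -4 ∧ spl p = 2) ∧ (W.conductorNorm ℤ = Nplus * Nminus ∧ Nat.Coprime Nplus Nminus ∧ Squarefree Nminus ∧ Odd Nminus.primeFactors.card ∧ (∀ q : ℕ, q.Prime → q ∣ Nplus → spl q = 2) ∧ (∀ q : ℕ, q.Prime → q ∣ Nminus → spl q = 1 ∧ ¬ (p : ℤ) ∣ padicValRat q W.Δ)) ∧ (a < 0 ∧ b < 0 ∧ (∀ (q : ℕ) [Fact q.Prime], (∀ x : QuaternionAlgebra ℚ_[q] (a : ℚ_[q]) 0 (b : ℚ_[q]), x ≠ 0 → IsUnit x) ↔ q ∣ Nminus) ∧ ∃ O₁ O₂ : Subring B, (∀ S : Subring B, (S = O₁ ∨ S = O₂) → (S.toAddSubgroup.FG ∧ (∀ d : B, ∃ n : ℤ, n ≠ 0 ∧ n • d ∈ S) ∧ ∀ S' : Subring B, S'.toAddSubgroup.FG → S ≤ S' → S' = S)) ∧ O = O₁ ⊓ O₂ ∧ O.toAddSubgroup.relIndex O₁.toAddSubgroup = Nplus) ∧ (HG I₁ ∧ ∀ c, ClassGroup.mk0 (a₀ c) = c ∧ IsCoprime (a₀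 c).1 (Ideal.span {(p : R)}) ∧ Ideal.span {α c} = (a₀ c).1 ^ hK ∧ HG (L c) ∧ PT (L c))) → ∃ C₂ : ℕ, ∀ (F : Type) [Field F] [NumberField F] [Algebra K F] (𝔓 : IsDedekindDomain.HeightOneSpectrum (NumberField.RingOfIntegers F)) (ι : B →ₐ[ℚ] Matrix (Fin 2) (Fin 2) F) (e e' : Fin 2 → F), let val := 𝔓.valuation F; let PR : (Fin 2 → F) → Prop := fun w => (∀ i, val (w i) ≤ 1) ∧ ∃ i, val (w i) = 1; let ρ : Bˣ → MvPolynomial (Fin 2) F → MvPolynomial (Fin 2) F := fun β P => MvPolynomial.aeval (fun j : Fin 2 => ∑ i : Fin 2, MvPolynomial.X (R := F) i * MvPolynomial.C (ι β.1 i j)) P; (((p : NumberField.RingOfIntegers F) ∈ 𝔓.asIdeal ∧ ∀ x ∈ O, ∀ i j, val (ι x i j) ≤ 1) ∧ ((∀ t, Matrix.vecMul e (ι (ψ t)) = (algebraMap K F t) • e) ∧ (∀ t, Matrix.vecMul e' (ι (ψ t)) = (algebraMap K F (Algebra.trace ℚ K t) - algebraMap K F t) • e') ∧ (∀ i, val (e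 i) ≤ 1) ∧ (∀ i, val (e' i) ≤ 1) ∧ val (e 0 * e' 1 - e 1 * e' 0) = 1)) → ∀ (N k : ℕ) (lam : ℕ → F) (Φ : Λ → MvPolynomial (Fin 2) F), ((2 < k ∧ 2 * (p - 1) * p ^ N ∣ k - 2 ∧ 2 * (p - 1) * p ^ N * hK ∣ k - 2) ∧ (∀ I ∈ RI, (Φ I).IsHomogeneous (k - 2)) ∧ (∀ (β : Bˣ), ∀ I ∈ RI, Φ (I.map (AddMonoidHom.mulLeft β.1).toIntLinearMap) = ρ β (Φ I)) ∧ (∀ q : ℕ, q.Prime → ¬ q ∣ Nplus * Nminus → ∀ I ∈ RI, ∑ᶠ J ∈ {J : Λ | J ≤ I ∧ J.toAddSubgroup.relIndex I.toAddSubgroup = q ^ 2 ∧ ∀ y ∈ J, ∀ x ∈ O, y * x ∈ J}, Φ J = lam q • Φ I) ∧ (∀ q : ℕ, q.Prime → ¬ q ∣ Nplus * Nminus * p → val (lam q - (W.frobeniusTrace q : F)) ≤ val (p : F) ^ (N + 1)) ∧ val (lam p) = 1 ∧ ∃ I ∈ RI, PT I ∧ Φ I ≠ 0) → ∃ I₀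 ∈ RI, PT I₀ ∧ ∃ e₀ : Fin 2 → F, PR e₀ ∧ ∃ j : ℕ, val (∑ c, (algebraMap K F (α c : K))⁻¹ ^ ((k - 2) / hK) * MvPolynomial.eval e (Φ (L c))) ^ 2 ≤ val (MvPolynomial.eval e₀ (Φ I₀)) ^ 2 * val (p : F) ^ j ∧ Nat.card ↥((W.baseChange K).selmerGroup ((p : ℤ) ^ (N + 1))) ≤ p ^ (j + C₂) := by
  sorry

namespace Statement

/-- The statement of `stub_selmerLengthLB`, by name (skeleton protocol: composition hypotheses are declared stubs). -/
abbrev stub_selmerLengthLB : Prop := type_of% @ToricControl.stub_selmerLengthLB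
/-- The statement of `stub_uniformToricControl`, by name. -/
abbrev stub_uniformToricControl : Prop := type_of% @ToricControl.stub_uniformToricControl

end Statement

/-- **Composition (rev 4).** The single open stub (uniform toric control) gives the restated crux `VerticalSelmerBound`
(item stmt-BirchSwinnertonDyer-18131) by name; the Selmer-length lower bound `stub_selmerLengthLB` (LANDED, p159065) is
discharged inside the proof. Pure ℕ-arithmetic: `p^((N+1)s) ≤ #Sel·p^c` and `#Sel ≤ p^(j+C₂)` give `(N+1)s ≤ j + C₂ + c`. -/
theorem VerticalSelmerBound_of (hDeep : Statement.stub_uniformToricControl) :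
    Summit.BirchSwinnertonDyer.BirchSwinnertonDyer.Theses.VerticalContact.VerticalSelmerBound := by
  have hLB : Statement.stub_selmerLengthLB := stub_selmerLengthLB
  intro W _ _ p _ K _ _ Nplus Nminus a b B R O ψ I₁ a₀ α Λ hK dK spl RI PT L HG hFree
  have hp : p.Prime := Fact.out
  obtain ⟨c, hc⟩ := hLB W p K hFree.2.1.1
  obtain ⟨C₂, hC₂⟩ := hDeep W p K Nplus Nminus a b O ψ I₁ a₀ α hFree
  refine ⟨C₂ + c, ?_⟩
  intro F _ _ _ 𝔓 ι e e' val PR ρ hFdep N k lam Φ hForm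
  obtain ⟨I₀, hI₀, hPT, e₀, he₀, j, hineq, hcard⟩ := hC₂ F 𝔓 ι e e' hFdep N k lam Φ hForm
  refine ⟨I₀, hI₀, hPT, e₀, he₀, j, hineq, ?_⟩
  have hpow : p ^ ((N + 1) * (W.selmerCorank p + (W.quadraticTwist (dK : ℚ)).selmerCorank p)) ≤
      p ^ (j + C₂ + c) := by
    calc p ^ ((N + 1) * (W.selmerCorank p + (W.quadraticTwist (dK : ℚ)).selmerCorank p))
        ≤ Nat.card ↥((W.baseChange K).selmerGroup ((p : ℤ) ^ (N + 1))) * p ^ c := hc (N + 1)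
      _ ≤ p ^ (j + C₂) * p ^ c := Nat.mul_le_mul_right _ hcard
      _ = p ^ (j + C₂ + c) := by rw [← pow_add]
  have hle := (Nat.pow_le_pow_iff_right hp.one_lt).mp hpow
  omega

end Summit.BirchSwinnertonDyer.BirchSwinnertonDyer.Cruxes.VerticalSelmerBound.ToricControl
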